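import Summits.HodgeConjecture.CorCM.HypDel.ExtAmbientReceptacleQArchA
import Literature.NumberTheory.Transcendental.AnalytificationUnramifiedClosedImmersion
import Literature.NumberTheory.Transcendental.AnalytificationExistenceProofs
import Literature.NumberTheory.Transcendental.AnalytificationFunctorialityProofs
import Literature.AlgebraicGeometry.ModuliOfAbelianVarieties.SiegelModuliDatumLocalBiholomorphism
import Literature.AlgebraicGeometry.ShimuraVarieties.UnitaryBallUniformisationLocalBiholomorphism
import Literature.AlgebraicGeometry.ShimuraVarieties.UnitaryAuxiliaryTorusClassNumberProofs
import Literature.AlgebraicGeometry.Motives.FiniteCoproductVarieties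
import Literature.AlgebraicGeometry.Motives.VarietiesProperProofs
import Literature.AlgebraicGeometry.HodgeTheory.RelativeHyperplaneClassHodgeRiemann
import HarnessLib

/-!
# T3 v4 `stub_S2imm : S2Imm` — the closed-immersion stub of the HDel Q-architecture, from the PERIOD CHART of `J_{β,Φ}`

Cell hodgecm-mathlib, fan B, crux `HDel` (item stmt-HodgeConjecture-24835), line `F1ExtHodgeType` v4 (B-plan2), KEY
`t3-stub-s2imm-period-map` (B-p05).  TARGET: `Summit.HodgeConjecture.CorCM.HypDel.ExtReceptacle.QArch.S2Imm` (★ τ0-v4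
`ExtAmbientReceptacleQArchA` :179): a morphism `ι' : Sh_{K_V × L_V}(G̃)_ℂ ⟶ Sh_{K_δ(N)}(GSp_δ)_ℂ` with the point formula
`PointFormulaN` and parametrised injectivity `ParamInjective` is a CLOSED IMMERSION ([Del71] Prop. 1.15).

PROOF (Step C of the line): ★ `IsAnalytification.isClosedImmersion_left_of_isProper_of_injective_of_injective_mfderiv`
(proper + injective on `ℂ`-points + injective analytic differential ⇒ closed immersion) fed with
* properness: the source `∐_{classGroup} Sc.Mc_{K_V}` is projective (★ `ComplexRecordSystem.projective`, finiteness of the class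
  group ★ `Aux.finite_classGroup_printed_holds`, ★ `isProjectiveOver_of_isColimit_cofan`), the target is separated;
* point-injectivity: every complex point of the source is a `summandPointExt` (★ `exists_sigmaHomeomorph_of_isColimit_cofan`,
  ★ `ShimuraSet.mk_surjective`), so `PointFormulaN` + `ParamInjective` + injectivity of `Sg.pts` give it;
* smoothness of the target of relative dimension `g(g+1)/2` (★ `SiegelModuliDatum.smoothOfRelativeDimension_base` on the pieces,
  ★ `smoothOfRelativeDimension_of_isColimit_cofan`), analytifications of both sides (★ `exists_isAnalytification_holds`), the
  analytification `fan` of `ι'` (★ `mdifferentiable_comp_map_holds`);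
* injective differential at a point: locally the source is uniformised by the ball (★ `ComplexRecordSystem.pieces`, ★
  `UnitaryBallUniformisationDatum.surjective_mfderiv_lift_map_unif_frameLift`), the target by `𝔥_g` (★
  `SiegelModuliDatum.injective_mfderiv_unif_lift` through ★ `isLocalHomeomorph_restrict_map_comp`), and between them the
  PERIOD CHART `P : 𝔹² → 𝔥_g` of `J_{β,Φ}` after the `GSp_δ(ℚ)`-translate `γ₁` read off the piece containing the image point
  (`SiegelShimuraSet.mk_eq_mk_iff`; `γ₁` has negative multiplier since `J_{β,Φ}(x) ∈ X⁻`, ★ `neg_auxComplexStructure_mem_C0`):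
  `ι'(ℂ) ∘ u_𝔹 = u_𝔥 ∘ P` on the ball, so ★ `injective_mfderiv_of_eventuallyEq_comp` applies once `P` is holomorphic with
  injective differential.

THIS FILE proves `S2Imm_of_periodChart (hP)`: `S2Imm` from the ONE analytic input `hP` = «for every `γ ∈ GSp_δ(ℝ)` moving all
`J_{β,Φ}(x)` into `S⁺`, `x ↦ Z(γ J_{β,Φ}(x) γ⁻¹) ∈ 𝔥_g` is holomorphic on `𝔹²` with injective differential» (KEY TARGET 1,
`Literature/AlgebraicGeometry/ShimuraVarieties/UnitaryAuxiliaryPeriodMap.lean`; [Del71] 1.14: a morphism of Shimura data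
induces a holomorphic immersion of the symmetric domains).  `stub_S2imm_holds` follows from it by one line once TARGET 1 lands.
HC_CM is proved only modulo the 7 printed citations until rung 0 closes; nothing here is a proof of I-1′ or of `HDel`.
[cite: Deligne1971TravauxShimura, Prop. 1.15, 1.14, 5.4] [cite: SGA1, Exp. XII Prop. 3.1] [cite: Grothendieck1967, IV₄ Cor. 18.12.6]
-/

set_option linter.dupNamespace false

noncomputable section

open Function MulAction Topology NumberField IsDedekindDomain CategoryTheory CategoryTheory.Limits Matrix
  AlgebraicGeometry Set Filter
open scoped Matrix ComplexOrder Manifold ContDiff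
open Literature.AlgebraicGeometry Literature.AlgebraicGeometry.Motives Literature.AlgebraicGeometry.Motives.AlgPoints
open Literature.NumberTheory.Automorphic Literature.NumberTheory.Automorphic.UnitaryGroup
open Literature.NumberTheory.Automorphic.Liu2021.AppendixC (C5.OpenCompactSubgroup C5.SmallLevel)
open Literature.Geometry.ComplexHyperbolic Literature.Geometry.ComplexHyperbolic.BallModel
open Literature.AlgebraicGeometry.ShimuraVarieties Literature.AlgebraicGeometry.ShimuraVarieties.UnitaryCanonicalModel
open Literature.AlgebraicGeometry.ShimuraVarieties.UnitaryCanonicalModel.Aux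
open Literature.AlgebraicGeometry.ModuliOfAbelianVarieties
open Literature.AlgebraicGeometry.ModuliOfAbelianVarieties.SiegelModuli (C0 jOfSiegel)
open Literature.AlgebraicGeometry.HodgeTheory (IsQuasiProjectiveOver)
open Literature.NumberTheory.Transcendental
open Literature.NumberTheory.ModularForms.SiegelUpperHalfSpace (siegelUpperHalfSpaceCoord coordCLE
  isOpen_siegelUpperHalfSpaceCoord mem_siegelUpperHalfSpaceCoord_iff)
open Literature.LinearAlgebra.Matrix (symmetricSubmodule)
open Summit.HodgeConjecture.CorCM.HypDel.ExtReceptacle.QArch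

namespace Summit.HodgeConjecture.HodgeConjecture.Theorems

/-- `Tᴴ A T` is the tree's `formCongr (starRingEnd ℂ) T A` (`conjTranspose = transpose ∘ map star`), so that the frame
hypothesis `hT` of the I-1′ binder block is a Sylvester frame of every ball piece. [cite: BergeronMillsonMoeglin2016Balls, Part 2 §1.1] -/
theorem conjTranspose_mul_mul_eq_formCongr (T : GL (Fin 3) ℂ) (A : Matrix (Fin 3) (Fin 3) ℂ) :
    (T : Matrix (Fin 3) (Fin 3) ℂ)ᴴ * A * (T : Matrix (Fin 3) (Fin 3) ℂ) = formCongr (starRingEnd ℂ) T A := by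
  rfl

-- one long assembly (≈ 40 named steps over two analytifications); the default budget does not suffice, as for the
-- cell's other Summits assemblies (`A3Liu413SepWeightOneAt`, `ClosedPrintedIota1HomNeZero`).
set_option maxHeartbeats 1600000 in
/-- **`S2Imm` from the period chart (KEY TARGET 1).**  If for every I-1′ datum and every `γ ∈ GSp_δ(ℝ)` with
`γ J_{β,Φ}(x) γ⁻¹ ∈ S⁺` for all `x ∈ 𝔹²` there is a map `P : ℂ² → ℂ^{g(g+1)/2}`, holomorphic on `𝔹²` with injective
differential, with `P(x) ∈ 𝔥_g` and `γ J_{β,Φ}(x) γ⁻¹ = J(Z(P x))` (Lange's complex structure of the period matrix), then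
`S2Imm` holds: every `ι'` with `PointFormulaN` and `ParamInjective` is a closed immersion.
[cite: Deligne1971TravauxShimura, Prop. 1.15 and 1.14] [cite: SGA1, Exp. XII Prop. 3.1] -/
theorem S2Imm_of_periodChart
    (hP : ∀ (L : Type) [Field L] [NumberField L] [IsCMField L] (H : Matrix (Fin 3) (Fin 3) L) (τ : L →+* ℂ)
      (T : GL (Fin 3) ℂ), formCongr (starRingEnd ℂ) T (H.map τ) = BallModel.J →
      (∀ τ' : L →+* ℂ, InfinitePlace.mk τ' ≠ InfinitePlace.mk τ → (H.map τ').PosDef) →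
      ∀ (M : Type) [Field M] [NumberField M] [IsCMField M] (j : L →+* M) (Φ : CMType M), IsExtAdapted τ j Φ →
      ∀ (ξ₀ ξ : M) (g : ℕ) (δ : Fin g → ℕ) (F : SymplecticFrame M j H ξ₀ ξ g δ),
      IsAuxScalars M Φ ξ₀ ξ → 0 < g → IsPolarizationType δ →
      ∀ γ : ↥(gspReal δ), (∀ x : Ball, conjJ (γ : GL (Fin g ⊕ Fin g) ℝ) (auxComplexStructure F τ Φ T x) ∈ C0 δ) →
        ∃ P : (Fin 2 → ℂ) → (Sym2 (Fin g) → ℂ), DifferentiableOn ℂ P BallForms.ballSet ∧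
          (∀ w ∈ BallForms.ballSet, Function.Injective (fderiv ℂ P w)) ∧
          ∀ x : Ball, P x.1 ∈ siegelUpperHalfSpaceCoord g ∧
            conjJ (γ : GL (Fin g ⊕ Fin g) ℝ) (auxComplexStructure F τ Φ T x) =
              jOfSiegel δ (((coordCLE g).symm (P x.1) : symmetricSubmodule (Fin g) ℂ) : Matrix (Fin g) (Fin g) ℂ)) :
    S2Imm := by
  intro L _ _ _ H τ T hT hpos hanis K₀ hneat Sc M _ _ _ j Φ hΦ ξ₀ ξ g δ F haux hg hpol hJ Sg N hN KV LV hprod ι'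
    hPF hPI
  classical
  have hδ : ∀ i, 0 < δ i := hpol.1
  -- §1 the source: a finite coproduct of smooth projective surfaces
  haveI hfin : Finite (classGroup M LV) := finite_classGroup_printed_holds M LV
  have hcX : IsColimit (Cofan.mk ((complexSystemExt M Sc LV).obj KV) (Sigma.ι (fun _ : classGroup M LV => Sc.Mc.obj KV))) :=
    coproductIsCoproduct _
  have hXproj : IsProjectiveOver ((complexSystemExt M Sc LV).obj KV) := isProjectiveOver_of_isColimit_cofan hcX fun _ => Sc.projective KV
  haveI hXsm : SmoothOfRelativeDimension 2 ((complexSystemExt M Sc LV).obj KV).hom :=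
    smoothOfRelativeDimension_of_isColimit_cofan hcX fun _ => Sc.smooth KV
  haveI : IsProper ((complexSystemExt M Sc LV).obj KV).hom := hXproj.isProper
  haveI : LocallyOfFiniteType ((complexSystemExt M Sc LV).obj KV).hom := inferInstance
  haveI : IsSeparated ((complexSystemExt M Sc LV).obj KV).hom := inferInstance
  obtain ⟨hcX'⟩ := Morphisms.isColimit_cofan_left hcX
  haveI hιX : ∀ c, IsOpenImmersion (Sigma.ι (fun _ : classGroup M LV => Sc.Mc.obj KV) c).left :=
    Morphisms.isOpenImmersion_of_isColimit_cofan hcX'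
  -- §2 the target: a finite coproduct of Siegel moduli bases, smooth of relative dimension `g(g+1)/2`, separated
  haveI hYsm : SmoothOfRelativeDimension (g * (g + 1) / 2) (Sg.Mc.obj (SiegelLevel.ofNat δ N hN)).hom :=
    smoothOfRelativeDimension_of_isColimit_cofan (Sg.isColimit (SiegelLevel.ofNat δ N hN)) fun q =>
      (Sg.datum (SiegelLevel.ofNat δ N hN) q).smoothOfRelativeDimension_base hδ (SiegelLevel.ofNat δ N hN).three_le_N
  haveI : IsSeparated (Sg.Mc.obj (SiegelLevel.ofNat δ N hN)).hom := (Sg.quasiProjective (SiegelLevel.ofNat δ N hN)).isSeparated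
  haveI : Smooth (Sg.Mc.obj (SiegelLevel.ofNat δ N hN)).hom := Sg.smooth (SiegelLevel.ofNat δ N hN)
  haveI : LocallyOfFinitePresentation (Sg.Mc.obj (SiegelLevel.ofNat δ N hN)).hom := inferInstance
  haveI : LocallyOfFiniteType (Sg.Mc.obj (SiegelLevel.ofNat δ N hN)).hom := inferInstance
  obtain ⟨hcY'⟩ := Morphisms.isColimit_cofan_left (Sg.isColimit (SiegelLevel.ofNat δ N hN))
  haveI hιY : ∀ q, IsOpenImmersion (Sg.incl (SiegelLevel.ofNat δ N hN) q).left := Morphisms.isOpenImmersion_of_isColimit_cofan hcY'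
  haveI : IsProper ι'.left := by
    have : IsProper (ι'.left ≫ (Sg.Mc.obj (SiegelLevel.ofNat δ N hN)).hom) := by rw [Over.w ι']; infer_instance
    exact IsProper.of_comp ι'.left (Sg.Mc.obj (SiegelLevel.ofNat δ N hN)).hom
  -- §3 analytifications and the analytification `fan` of `ι'`
  obtain ⟨MX, _, _, _, _, φ, hφ⟩ := exists_isAnalytification_holds ((complexSystemExt M Sc LV).obj KV) 2
  obtain ⟨MY, _, _, _, _, ψ, hψ⟩ := exists_isAnalytification_holds (Sg.Mc.obj (SiegelLevel.ofNat δ N hN)) (g * (g + 1) / 2)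
  obtain ⟨fan, hfan_def⟩ : ∃ fan : MX → MY, fan = fun m => hψ.homeomorph.symm (AlgPoints.map ι' (φ m)) :=
    ⟨_, rfl⟩
  have hcomm : ∀ m, ψ (fan m) = AlgPoints.map ι' (φ m) := fun m => by
    rw [hfan_def]
    simpa only [hψ.coe_homeomorph] using hψ.homeomorph.apply_symm_apply (AlgPoints.map ι' (φ m))
  have hfan : MDifferentiable 𝓘(ℂ, Fin 2 → ℂ) 𝓘(ℂ, Fin (g * (g + 1) / 2) → ℂ) fan :=
    IsAnalytification.mdifferentiable_comp_map_holds hφ hψ ι' fan (funext hcomm)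
  -- §4 every complex point of the source is a `summandPointExt`; point-injectivity of `ι'`
  obtain ⟨ΦX, hΦX⟩ := Motives.exists_sigmaHomeomorph_of_isColimit_cofan ℂ hcX
  have hsurjX : ∀ P : ComplexPoints ((complexSystemExt M Sc LV).obj KV), ∃ (c : classGroup M LV) (x : Ball)
      (a : finAdelic (↥(maximalRealSubfield L)) L (IsCMField.complexConj L) 3 H),
      P = summandPointExt M Sc LV KV c x a := by
    intro P
    obtain ⟨⟨c, Q⟩, rfl⟩ := ΦX.surjective P
    obtain ⟨⟨x, a⟩, hxa⟩ := ShimuraSet.mk_surjective (L := L) (H := H) (τ := τ) (T := T) (hT := hT)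
      (K := KV.1.1) (Sc.pts KV Q)
    refine ⟨c, x, a, ?_⟩
    have hQ : Q = (Sc.pts KV).symm (ShimuraSet.mk L H τ T hT KV.1.1 x a) := by
      rw [← (Sc.pts KV).symm_apply_apply Q]
      exact congrArg (Sc.pts KV).symm hxa.symm
    rw [hΦX, hQ]
    rfl
  have hinjpt : Function.Injective (AlgPoints.map ι' : ComplexPoints ((complexSystemExt M Sc LV).obj KV) → ComplexPoints (Sg.Mc.obj (SiegelLevel.ofNat δ N hN))) := by
    intro P₁ P₂ h12
    obtain ⟨c₁, x₁, a₁, rfl⟩ := hsurjX P₁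
    obtain ⟨c₂, x₂, a₂, rfl⟩ := hsurjX P₂
    obtain ⟨t₁, ht₁⟩ := QuotientGroup.mk_surjective c₁
    obtain ⟨t₂, ht₂⟩ := QuotientGroup.mk_surjective c₂
    have h1 := hPF c₁ x₁ a₁ t₁ ht₁
    have h2 := hPF c₂ x₂ a₂ t₂ ht₂
    rw [h1, h2] at h12
    have h12' := (Sg.pts (SiegelLevel.ofNat δ N hN)).symm.injective h12
    obtain ⟨hmk, hcl⟩ := hPI x₁ x₂ a₁ a₂ t₁ t₂ h12'
    have hc : c₁ = c₂ := by rw [← ht₁, ← ht₂]; exact hcl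
    subst hc
    unfold summandPointExt
    rw [hmk]
  -- §5 injective differential of `fan` at every point
  have hinj : ∀ p : MX,
      Function.Injective (mfderiv 𝓘(ℂ, Fin 2 → ℂ) 𝓘(ℂ, Fin (g * (g + 1) / 2) → ℂ) fan p) := by
    intro p
    -- locate `φ p` on a summand `c` and a ball piece `q`
    obtain ⟨⟨c, Q⟩, hcQ⟩ := ΦX.surjective (φ p)
    obtain ⟨gq, hgq, Xq, ιq, hcq, B, hB⟩ := Sc.pieces KV
    obtain ⟨Φq, hΦq⟩ := Motives.exists_sigmaHomeomorph_of_isColimit_cofan ℂ hcq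
    obtain ⟨⟨q, R⟩, hqR⟩ := Φq.surjective Q
    let 𝔣 : (B q).SylvesterFrame :=
      ⟨T, by rw [(hB q).1, conjTranspose_mul_mul_eq_formCongr]; exact hT⟩
    obtain ⟨z, hz⟩ := (B q).ballUnifMap_surjective 𝔣 R
    obtain ⟨hcq'⟩ := Morphisms.isColimit_cofan_left hcq
    haveI : ∀ q, IsOpenImmersion (ιq q).left := Morphisms.isOpenImmersion_of_isColimit_cofan hcq'
    obtain ⟨jq, hjq⟩ : ∃ jq : Xq q ⟶ ((complexSystemExt M Sc LV).obj KV),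
        jq = ιq q ≫ Sigma.ι (fun _ : classGroup M LV => Sc.Mc.obj KV) c := ⟨_, rfl⟩
    have hιq : IsOpenImmersion (ιq q).left := inferInstance
    haveI : IsOpenImmersion jq.left := by
      rw [hjq, Over.comp_left]
      exact @IsOpenImmersion.comp _ _ _ _ _ hιq (hιX c)
    have hmc : ∀ R : ComplexPoints (Xq q), AlgPoints.map jq R =
        AlgPoints.map (Sigma.ι (fun _ : classGroup M LV => Sc.Mc.obj KV) c) (AlgPoints.map (ιq q) R) :=
      fun R => by rw [hjq]; exact AlgPoints.map_comp_apply _ _ _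
    -- the ball uniformisation of the summand through `jq`
    obtain ⟨uB, huB⟩ : ∃ uB : (Fin 2 → ℂ) → ComplexPoints ((complexSystemExt M Sc LV).obj KV),
        uB = AlgPoints.map jq ∘ fun w : Fin 2 → ℂ => (B q).unif (𝔣.t *ᵥ ![w 0, w 1, 1]) := ⟨_, rfl⟩
    obtain ⟨tc, htc⟩ := QuotientGroup.mk_surjective c
    have huB_eq : ∀ x : Ball, uB x.1 = summandPointExt M Sc LV KV c x (gq q) := by
      intro x
      have h3 := (hB q).2.2 x
      rw [huB, Function.comp_apply, hmc,
        show 𝔣.t *ᵥ ![x.1 0, x.1 1, 1] = (T : Matrix (Fin 3) (Fin 3) ℂ) *ᵥ BallModel.lift x from rfl, h3]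
      rfl
    have hιuB : ∀ x : Ball, AlgPoints.map ι' (uB x.1) =
        (Sg.pts (SiegelLevel.ofNat δ N hN)).symm (SiegelShimuraSet.mk δ (SiegelLevel.ofNat δ N hN).1 ⟨auxComplexStructure F τ Φ T x, hJ x⟩
          (auxToGspFin F (gq q, tc))) := by
      intro x; rw [huB_eq]; exact hPF c x (gq q) tc htc
    -- the target piece `q'` through the image of `z` and the rational translate `γ₁`
    obtain ⟨q', Z₀, hZ₀, hpt⟩ := Sg.exists_pts_eq_mk hδ (SiegelLevel.ofNat δ N hN) (AlgPoints.map ι' (uB z.1))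
    have hmk0 : SiegelShimuraSet.mk δ (SiegelLevel.ofNat δ N hN).1 ⟨jOfSiegel δ Z₀, SiegelComplexRecordSystem.jOfSiegel_mem_C0pm hδ hZ₀⟩
        (Sg.rep (SiegelLevel.ofNat δ N hN) q') =
        SiegelShimuraSet.mk δ (SiegelLevel.ofNat δ N hN).1 ⟨auxComplexStructure F τ Φ T z, hJ z⟩ (auxToGspFin F (gq q, tc)) := by
      rw [← hpt, hιuB, Equiv.apply_symm_apply]
    obtain ⟨γ₁, hγJ, hγa⟩ := (SiegelShimuraSet.mk_eq_mk_iff δ (SiegelLevel.ofNat δ N hN).1 _ _ _ _).1 hmk0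
    obtain ⟨γ, hγ⟩ : ∃ γ : ↥(gspReal δ), γ = gspRationalToReal δ γ₁ := ⟨_, rfl⟩
    -- sign bookkeeping: `γ` moves every `J_{β,Φ}(x)` into `S⁺`
    have hξ₀' : ∀ ρ : Φ.1, (ρ.1 ξ₀).im < 0 := fun ρ => (haux.2.2 ρ.1 ρ.2).1
    have hξ' : ∀ ρ : Φ.1, (ρ.1 ξ).im < 0 := fun ρ => (haux.2.2 ρ.1 ρ.2).2
    have hnegC0 : ∀ x : Ball, -auxComplexStructure F τ Φ T x ∈ C0 δ :=
      fun x => neg_auxComplexStructure_mem_C0 F τ Φ T x hT hξ₀' hξ' hpos hΦ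
    have hγz : conjJ (γ : GL (Fin g ⊕ Fin g) ℝ) (auxComplexStructure F τ Φ T z) ∈ C0 δ := by
      have h1 := congrArg Subtype.val hγJ
      simp only [coe_conjAct] at h1
      rw [hγ, h1]
      exact SiegelModuli.jOfSiegel_mem_C0 hδ hZ₀
    obtain ⟨ν, hν⟩ := exists_isMultiplier_realTypeForm γ.2
    have hνneg : (ν : ℝ) < 0 := by
      rcases lt_or_gt_of_ne (Units.ne_zero ν) with h | h
      · exact h
      · exfalso
        have h1 : conjJ (γ : GL (Fin g ⊕ Fin g) ℝ) (-auxComplexStructure F τ Φ T z) ∈ C0 δ :=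
          conjJ_mem_C0_of_pos hν h (hnegC0 z)
        rw [conjJ_neg] at h1
        exact neg_not_mem_C0_of_mem_C0 hg hγz h1
    have hγC0 : ∀ x : Ball, conjJ (γ : GL (Fin g ⊕ Fin g) ℝ) (auxComplexStructure F τ Φ T x) ∈ C0 δ := by
      intro x
      have h1 := neg_conjJ_mem_C0_of_neg hν hνneg (hnegC0 x)
      rwa [conjJ_neg, neg_neg] at h1
    -- the period chart (KEY TARGET 1)
    obtain ⟨P, hPd, hPinj, hPx⟩ := hP L H τ T hT hpos M j Φ hΦ ξ₀ ξ g δ F haux hg hpol γ hγC0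
    -- the Siegel uniformisation of the piece `q'` through `incl`
    obtain ⟨uS, huS⟩ : ∃ uS : (Sym2 (Fin g) → ℂ) → ComplexPoints (Sg.Mc.obj (SiegelLevel.ofNat δ N hN)),
        uS = AlgPoints.map (Sg.incl (SiegelLevel.ofNat δ N hN) q') ∘ fun v : Sym2 (Fin g) → ℂ =>
          (Sg.datum (SiegelLevel.ofNat δ N hN) q').unif
            (((coordCLE g).symm v : symmetricSubmodule (Fin g) ℂ) : Matrix (Fin g) (Fin g) ℂ) := ⟨_, rfl⟩
    -- KEY IDENTITY on the ball: `ι'(ℂ) ∘ uB = uS ∘ P`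
    have hcoset : ((gspRationalToFinAdelic δ γ₁ : gspFinAdelic δ) * auxToGspFin F (gq q, tc) :
        gspFinAdelic δ ⧸ ((SiegelLevel.ofNat δ N hN).1 : Subgroup (gspFinAdelic δ))) = (Sg.rep (SiegelLevel.ofNat δ N hN) q' : gspFinAdelic δ ⧸ ((SiegelLevel.ofNat δ N hN).1 : Subgroup _)) := by
      rw [← smul_eq_mul, ← MulAction.Quotient.smul_coe]
      exact hγa
    have hkey : ∀ x : Ball, AlgPoints.map ι' (uB x.1) = uS (P x.1) := by
      intro x
      obtain ⟨hPmem, hPJ⟩ := hPx x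
      have hZx : (((coordCLE g).symm (P x.1) : symmetricSubmodule (Fin g) ℂ) : Matrix (Fin g) (Fin g) ℂ) ∈
          siegelUpperHalfSpace g := (mem_siegelUpperHalfSpaceCoord_iff).1 hPmem
      rw [hιuB x]
      simp only [huS, Function.comp_apply]
      rw [Sg.incl_unif (SiegelLevel.ofNat δ N hN) q' _ (SiegelComplexRecordSystem.jOfSiegel_mem_C0pm hδ hZx) hZx]
      congr 1
      rw [← SiegelShimuraSet.mk_conjAct_smul δ (SiegelLevel.ofNat δ N hN).1 γ₁]
      have hJ' : conjAct δ (gspRationalToReal δ γ₁) ⟨auxComplexStructure F τ Φ T x, hJ x⟩ =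
          ⟨jOfSiegel δ (((coordCLE g).symm (P x.1) : symmetricSubmodule (Fin g) ℂ) : Matrix (Fin g) (Fin g) ℂ),
            SiegelComplexRecordSystem.jOfSiegel_mem_C0pm hδ hZx⟩ := by
        apply Subtype.ext
        rw [coe_conjAct]
        show _ = jOfSiegel δ _
        rw [← hPJ, hγ]
      rw [hJ']
      simp only [SiegelShimuraSet.mk, hcoset]
    -- the lifts to the analytifications
    obtain ⟨uBl, huBl⟩ : ∃ uBl : (Fin 2 → ℂ) → MX, uBl = hφ.homeomorph.symm ∘ uB := ⟨_, rfl⟩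
    obtain ⟨uSl, huSl⟩ : ∃ uSl : (Sym2 (Fin g) → ℂ) → MY, uSl = hψ.homeomorph.symm ∘ uS := ⟨_, rfl⟩
    have hφuB : φ p = uB z.1 := by
      rw [← hcQ, hΦX, ← hqR, hΦq, ← hz, huB, Function.comp_apply, hmc]
      rfl
    have hzp : uBl z.1 = p := by
      simp only [huBl, Function.comp_apply, ← hφuB]
      have := hφ.homeomorph.symm_apply_apply p
      rwa [hφ.coe_homeomorph] at this
    have huBl' : MDifferentiableAt 𝓘(ℂ, Fin 2 → ℂ) 𝓘(ℂ, Fin 2 → ℂ) uBl z.1 := by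
      rw [huBl, huB]
      exact (B q).mdifferentiableAt_lift_map_unif_frameLift 𝔣 jq hφ (BallForms.coe_mem_ballSet z)
    have hsurj : Function.Surjective (mfderiv 𝓘(ℂ, Fin 2 → ℂ) 𝓘(ℂ, Fin 2 → ℂ) uBl z.1) := by
      rw [huBl, huB]
      exact (B q).surjective_mfderiv_lift_map_unif_frameLift 𝔣 jq hφ (BallForms.coe_mem_ballSet z)
    have hcommB : fan ∘ uBl =ᶠ[𝓝 z.1] uSl ∘ P := by
      filter_upwards [BallForms.isOpen_ballSet.mem_nhds (BallForms.coe_mem_ballSet z)] with w hw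
      have hφφ : φ (hφ.homeomorph.symm (uB w)) = uB w := by
        simpa only [hφ.coe_homeomorph] using hφ.homeomorph.apply_symm_apply (uB w)
      simp only [Function.comp_apply, hfan_def, huBl, huSl, hφφ, hkey ⟨w, hw⟩]
    -- the target side: `uS` is a holomorphic local homeomorphism on `𝔥_g`
    have hlocS : IsLocalHomeomorph ((siegelUpperHalfSpaceCoord g).restrict uS) := by
      rw [huS]
      exact isLocalHomeomorph_restrict_map_comp
        ((Sg.datum (SiegelLevel.ofNat δ N hN) q').isLocalHomeomorph_restrict_unif_coord hδ
          (SiegelLevel.ofNat δ N hN).three_le_N) (Sg.incl (SiegelLevel.ofNat δ N hN) q')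
    have hcontS : ContinuousOn (fun v : Sym2 (Fin g) → ℂ =>
        (Sg.datum (SiegelLevel.ofNat δ N hN) q').unif (((coordCLE g).symm v : symmetricSubmodule (Fin g) ℂ) : Matrix (Fin g) (Fin g) ℂ))
        (siegelUpperHalfSpaceCoord g) := by
      rw [continuousOn_iff_continuous_restrict]
      exact ((Sg.datum (SiegelLevel.ofNat δ N hN) q').isLocalHomeomorph_restrict_unif_coord hδ (SiegelLevel.ofNat δ N hN).three_le_N).continuous
    have hholS := differentiableOn_evalOrZero_map_comp isOpen_siegelUpperHalfSpaceCoord hcontS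
      ((Sg.datum (SiegelLevel.ofNat δ N hN) q').differentiableOn_unif_coord) (Sg.incl (SiegelLevel.ofNat δ N hN) q')
    rw [← huS] at hholS
    have hPz : P z.1 ∈ siegelUpperHalfSpaceCoord g := (hPx z).1
    have huSl' : MDifferentiableAt 𝓘(ℂ, Sym2 (Fin g) → ℂ) 𝓘(ℂ, Fin (g * (g + 1) / 2) → ℂ) uSl (P z.1) := by
      rw [huSl]
      exact hψ.mdifferentiableAt_symm_comp_of_isLocalHomeomorph isOpen_siegelUpperHalfSpaceCoord hlocS hholS hPz
    have hinjS : Function.Injective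
        (mfderiv 𝓘(ℂ, Sym2 (Fin g) → ℂ) 𝓘(ℂ, Fin (g * (g + 1) / 2) → ℂ) uSl (P z.1)) := by
      rw [huSl]
      exact hψ.injective_mfderiv_symm_comp isOpen_siegelUpperHalfSpaceCoord hlocS hholS hPz
    have hPdz : DifferentiableAt ℂ P z.1 :=
      hPd.differentiableAt (BallForms.isOpen_ballSet.mem_nhds (BallForms.coe_mem_ballSet z))
    have hinjg : Function.Injective
        (mfderiv 𝓘(ℂ, Fin 2 → ℂ) 𝓘(ℂ, Fin (g * (g + 1) / 2) → ℂ) (uSl ∘ P) z.1) :=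
      injective_mfderiv_comp_of_injective huSl' hPdz hinjS (hPinj z.1 (BallForms.coe_mem_ballSet z))
    exact injective_mfderiv_of_eventuallyEq_comp hzp huBl' hsurj (hfan p) hcommB hinjg
  exact hφ.isClosedImmersion_left_of_isProper_of_injective_of_injective_mfderiv hψ ι' hinjpt fan hcomm
    (fun p => hfan p) hinj

end Summit.HodgeConjecture.HodgeConjecture.Theorems
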